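import Mathlib
import HarnessLib
import Summits.ValiantsHypothesis.ValiantsHypothesis.Theses.MonotoneRestoration
import Literature.Computability.AlgebraicComplexity.ArithCircuit
import Literature.Computability.AlgebraicComplexity.SymmetricArithCircuit
import Literature.Computability.AlgebraicComplexity.SupportSymmetrisation
import Literature.Computability.AlgebraicComplexity.SupportSymmetrisationEval
import Summits.ValiantsHypothesis.ValiantsHypothesis.Theorems.MonotoneRestorationMonotoneRestorationQPCommutingMatricesNewton
import Summits.ValiantsHypothesis.ValiantsHypothesis.Theorems.MonotoneRestorationMonotoneRestorationQPRowScanRowBlocks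
import Summits.ValiantsHypothesis.ValiantsHypothesis.Theorems.MonotoneRestorationMonotoneRestorationQPRowScanProgram
import Summits.ValiantsHypothesis.ValiantsHypothesis.Theorems.MonotoneRestorationMonotoneRestorationQPEsymmRowSumsScan

/-!
# THEOREM δ — COMMUTING ROW SCANS RESTORE with polynomial symmetric size

Support file (`--supports stmt-ValiantsHypothesis-15886`) of line `Sketch`, lead c2 (cycle 3):
assembly of the side stubs D2–D5 of the registered skeleton (`Cruxes/…/Lines/Sketch.lean`).

A ROW SCAN on the `n × n` variable matrix: width `w`, row power sums
`p_d(r_i) = Σ_j x_ij^d` (`1 ≤ d ≤ D`), sparse entry templates `H a b ∈ ℂ[z_0,…,z_{D-1}]`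
(`≤ T` monomials, degree `≤ Eh`), boundary vectors `u v`; transfer matrices
`A_i = (H a b (p_1(r_i),…,p_D(r_i)))_{ab}` and scan value `Σ_{a,b} u_a (A_0 ⋯ A_{n-1})_{ab} v_b`.
These are the "order-exploiting dynamic programmes" that the route's planners named as the risk
for the crux `MonotoneRestorationQP` (`why_might_fail`). When the `A_i` pairwise COMMUTE — and
every EXCHANGEABLE scan has a commuting realisation of no larger width by the minimal-realisation
result D6 `stub_commutingRealisation` (landed, p145902) — the scan value has a
`Sym_n`-symmetric circuit over `ℂ` of size `poly(n, w, D, T, Eh)`: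

* `rowScan_symmetric_circuit` — THEOREM δ: `≤ (n + w + D + T + Eh + 2)^24` gates. Mechanism = the
  line's engine end to end: D3 `stub_rowScan_rowBlocks` + D4 `stub_rowScan_program` build ONE
  supported straight-line program of support width `2` (row blocks at supports `{i,j}`/`{i}`,
  global block at `∅`: power-sum matrices `P_d = Σ_i A_i^d`, Newton's recursion, output), D2
  `stub_commutingMatrices_newton` identifies the recursion's `E_n` with the ordered product, and
  S3 `SupportSymm.exists_symmetric_circuit_of_supports` symmetrises.
* `esymmRowSums_symmetric_circuit` — the instance `e_k(R_0,…,R_{n-1})` (D5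
  `stub_esymmRowSums_scan`: `A_i = I + R_i N`): a `Sym_n`-symmetric circuit over `ℂ` with
  `≤ (n + k + 7)^24` gates. Contrast THEOREM γ (`…QPGamma.lean`, `…QPGammaChooseLeCard.lean`):
  over `ℝ≥0` the same polynomial at `k = ⌊n/2⌋` needs `≥ C(n, ⌊n/6⌋) = 2^{Ω(n)}` gates.
* `monotoneRestorationQP_of_commutingScan` — the SLICE OF THE CRUX in its own currency: a
  matrix-symmetric family over `ℝ≥0` whose complexification is, for every `n`, the value of a
  commuting row scan with parameters `w, D, T, Eh ≤ (n+2)^c` has quasi-polynomial (indeed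
  polynomial) square-symmetric circuits — no monotonicity or degree hypothesis needed.
-/

-- `ValiantsHypothesis.ValiantsHypothesis`: the D-0017 layout repeats the problem name in the path.
set_option linter.dupNamespace false

namespace Summit.ValiantsHypothesis.ValiantsHypothesis.Theorems

open Literature.Computability.AlgebraicComplexity

/-- Size bookkeeping for Theorem δ: the symmetrised scan program is polynomial. [folklore] -/
theorem rowScan_size_le (n w D T Eh : ℕ) :
    3 * ((n + w + D + T + Eh + 2) ^ 8 + (n + w + 2) ^ 6 + 1) *
      (2 * ((n + w + 1) * (n + w + 1) + D + T + Eh) + 1) * (n + 1) ^ 4 ≤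
      (n + w + D + T + Eh + 2) ^ 24 := by
  have h1 : (n + w + 2) ^ 6 ≤ (n + w + D + T + Eh + 2) ^ 6 := Nat.pow_le_pow_left (by omega) 6
  have hC : (n + 1) ^ 4 ≤ (n + w + D + T + Eh + 2) ^ 4 := Nat.pow_le_pow_left (by omega) 4
  have hB : 2 * ((n + w + 1) * (n + w + 1) + D + T + Eh) + 1 ≤
      3 * (n + w + D + T + Eh + 2) ^ 2 := by
    have hsq : (n + w + D + T + Eh + 2) ^ 2 =
        (n + w + 1) * (n + w + 1) + 2 * (n + w + 1) * (D + T + Eh + 1) +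
          (D + T + Eh + 1) * (D + T + Eh + 1) := by ring
    rw [hsq]
    nlinarith [Nat.zero_le ((n + w + 1) * (D + T + Eh + 1)), Nat.zero_le ((n + w + 1) * (n + w + 1)),
      Nat.zero_le ((D + T + Eh + 1) * (D + T + Eh))]
  generalize hm : n + w + D + T + Eh + 2 = m at h1 hC hB ⊢
  have hm2 : 2 ≤ m := by omega
  have h2 : m ^ 6 ≤ m ^ 8 := Nat.pow_le_pow_right (by omega) (by omega)
  have h3 : 1 ≤ m ^ 8 := Nat.one_le_pow _ _ (by omega)
  have hA : m ^ 8 + (n + w + 2) ^ 6 + 1 ≤ 3 * m ^ 8 := by omega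
  calc 3 * (m ^ 8 + (n + w + 2) ^ 6 + 1) * (2 * ((n + w + 1) * (n + w + 1) + D + T + Eh) + 1) *
        (n + 1) ^ 4
      ≤ 3 * (3 * m ^ 8) * (3 * m ^ 2) * m ^ 4 :=
        Nat.mul_le_mul (Nat.mul_le_mul (Nat.mul_le_mul_left 3 hA) hB) hC
    _ = 27 * m ^ 14 := by ring
    _ ≤ m ^ 5 * m ^ 14 := by
        apply Nat.mul_le_mul_right
        calc 27 ≤ 2 ^ 5 := by norm_num
          _ ≤ m ^ 5 := Nat.pow_le_pow_left hm2 5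
    _ = m ^ 19 := by ring
    _ ≤ m ^ 24 := Nat.pow_le_pow_right (by omega) (by omega)

/-- **THEOREM δ (assembly) — commuting row scans have POLYNOMIAL-size square-symmetric circuits.**
For scan data `(w, D, H, u, v)` on the `n × n` matrix whose transfer matrices
`A_i = H(p_1(r_i),…,p_D(r_i))` pairwise commute, the scan value
`Σ_{a,b} u_a (A_0 ⋯ A_{n-1})_{ab} v_b` is computed by a `Sym_n`-symmetric labelled circuit over `ℂ`
with at most `(n + w + D + T + Eh + 2)^24` gates (`T`, `Eh` = sparsity and degree of the templates):
D3 + D4 give a supported program of width `2` computing `u · E_n · v` for a solution `E` of Newton's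
recursion, D2 identifies `E_n` with the ordered product, and S3
(`SupportSymm.exists_symmetric_circuit_of_supports`) symmetrises. [new] -/
theorem rowScan_symmetric_circuit (n w D T Eh : ℕ) (H : Fin w → Fin w → MvPolynomial (Fin D) ℂ)
    (hT : ∀ a b, (H a b).support.card ≤ T) (hE : ∀ a b, (H a b).totalDegree ≤ Eh)
    (u v : Fin w → ℂ)
    (hcomm : ∀ i i' : Fin n,
      (Matrix.of fun a b : Fin w => MvPolynomial.aeval
          (fun d : Fin D => ∑ j : Fin n, (MvPolynomial.X (i, j) : MvPolynomial (Fin n × Fin n) ℂ)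
            ^ ((d : ℕ) + 1)) (H a b)) *
      (Matrix.of fun a b : Fin w => MvPolynomial.aeval
          (fun d : Fin D => ∑ j : Fin n, (MvPolynomial.X (i', j) : MvPolynomial (Fin n × Fin n) ℂ)
            ^ ((d : ℕ) + 1)) (H a b)) =
      (Matrix.of fun a b : Fin w => MvPolynomial.aeval
          (fun d : Fin D => ∑ j : Fin n, (MvPolynomial.X (i', j) : MvPolynomial (Fin n × Fin n) ℂ)
            ^ ((d : ℕ) + 1)) (H a b)) *
      (Matrix.of fun a b : Fin w => MvPolynomial.aeval
          (fun d : Fin D => ∑ j : Fin n, (MvPolynomial.X (i, j) : MvPolynomial (Fin n × Fin n) ℂ)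
            ^ ((d : ℕ) + 1)) (H a b))) :
    ∃ (G : Type) (_ : Fintype G) (C : LabelledArithCircuit ℂ (Fin n × Fin n) Unit G),
      C.IsSymmetric (Equiv.Perm (Fin n)) ∧
      C.eval (C.output ()) = ∑ a : Fin w, ∑ b : Fin w,
        MvPolynomial.C (u a) *
          (List.ofFn fun i : Fin n => Matrix.of fun a' b' : Fin w => MvPolynomial.aeval
            (fun d : Fin D => ∑ j : Fin n, (MvPolynomial.X (i, j) : MvPolynomial (Fin n × Fin n) ℂ)
              ^ ((d : ℕ) + 1)) (H a' b')).prod a b *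
          MvPolynomial.C (v b) ∧
      Fintype.card G ≤ (n + w + D + T + Eh + 2) ^ 24 := by
  obtain ⟨L, K, idx, hL1, hL2, hL3, hL4, hL5, hL6, hL7, hLlen⟩ :=
    stub_rowScan_rowBlocks n w D T Eh H hT hE
  obtain ⟨P, K', E, hne, hA, hwf, hk, hprod, hinv, hout, hsize, hE0, hErec, heval⟩ :=
    stub_rowScan_program n w D T Eh H u v L K idx hL1 hL2 hL3 hL4 hL5 hL6 hL7
  have hEn := stub_commutingMatrices_newton
    (fun i : Fin n => Matrix.of fun a' b' : Fin w => MvPolynomial.aeval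
      (fun d : Fin D => ∑ j : Fin n, (MvPolynomial.X (i, j) : MvPolynomial (Fin n × Fin n) ℂ)
        ^ ((d : ℕ) + 1)) (H a' b')) hcomm E hE0 hErec
  obtain ⟨G, hG, C, hCs, hCe, hCc⟩ :=
    SupportSymm.exists_symmetric_circuit_of_supports 2 ((n + w + 1) * (n + w + 1) + D + T + Eh) P K' hne hA hwf
      hk hprod hinv hout
  refine ⟨G, hG, C, hCs, ?_, ?_⟩
  · rw [hCe, heval, hEn]
  · rw [show 2 + 2 = 4 from rfl] at hCc
    refine hCc.trans (le_trans ?_ (rowScan_size_le n w D T Eh))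
    have hs : P.size + 1 ≤ (n + w + D + T + Eh + 2) ^ 8 + (n + w + 2) ^ 6 + 1 := by omega
    exact Nat.mul_le_mul_right _ (Nat.mul_le_mul_right _ (Nat.mul_le_mul_left 3 hs))

/-- Templates of the `e_k` scan are sparse: `[a = b] + [a = b + 1]·z_0` has at most two monomials.
[folklore] -/
theorem esymmScan_template_support_card (k : ℕ) (a b : Fin (k + 1)) :
    ((if a = b then 1 else 0) +
      (if (a : ℕ) = (b : ℕ) + 1 then (MvPolynomial.X 0 : MvPolynomial (Fin 1) ℂ) else 0)).support.card
      ≤ 2 := by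
  classical
  refine (Finset.card_le_card (MvPolynomial.support_add)).trans ?_
  refine (Finset.card_union_le _ _).trans ?_
  have h1 : (if a = b then (1 : MvPolynomial (Fin 1) ℂ) else 0).support.card ≤ 1 := by
    split_ifs
    · rw [← MvPolynomial.C_1, MvPolynomial.C_apply, MvPolynomial.support_monomial]
      split_ifs <;> simp
    · simp
  have h2 : (if (a : ℕ) = (b : ℕ) + 1 then (MvPolynomial.X 0 : MvPolynomial (Fin 1) ℂ)
      else 0).support.card ≤ 1 := by
    split_ifs
    · rw [MvPolynomial.X, MvPolynomial.support_monomial]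
      split_ifs <;> simp
    · simp
  omega

/-- Templates of the `e_k` scan have degree `≤ 1`. [folklore] -/
theorem esymmScan_template_totalDegree (k : ℕ) (a b : Fin (k + 1)) :
    ((if a = b then 1 else 0) +
      (if (a : ℕ) = (b : ℕ) + 1 then (MvPolynomial.X 0 : MvPolynomial (Fin 1) ℂ) else 0)).totalDegree
      ≤ 1 := by
  refine (MvPolynomial.totalDegree_add _ _).trans (max_le ?_ ?_)
  · split_ifs
    · rw [MvPolynomial.totalDegree_one]; exact Nat.zero_le _
    · rw [MvPolynomial.totalDegree_zero]; exact Nat.zero_le _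
  · split_ifs
    · exact (MvPolynomial.totalDegree_X (R := ℂ) (0 : Fin 1)).le
    · rw [MvPolynomial.totalDegree_zero]; exact Nat.zero_le _

/-- On `Fin 1` the exponent `d + 1` is `0 + 1`: the general scan data at `D = 1` agree with the
form used in D5. [folklore] -/
theorem esymmScan_powFun_eq (n : ℕ) (i : Fin n) :
    (fun d : Fin 1 => ∑ j : Fin n, (MvPolynomial.X (i, j) : MvPolynomial (Fin n × Fin n) ℂ)
      ^ ((d : ℕ) + 1)) =
    (fun _ : Fin 1 => ∑ j : Fin n, (MvPolynomial.X (i, j) : MvPolynomial (Fin n × Fin n) ℂ)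
      ^ ((0 : ℕ) + 1)) := by
  funext d
  obtain rfl : d = 0 := Subsingleton.elim _ _
  rfl

/-- **`e_k` of the row sums has POLYNOMIAL-size square-symmetric circuits over `ℂ`.** For all
`n, k`, the polynomial `e_k(R_0,…,R_{n-1})`, `R_i = Σ_j x_ij`, is computed by a `Sym_n`-symmetric
labelled circuit over `ℂ` with at most `(n + k + 7)^24` gates: it is the value of the commuting
row scan `A_i = I + R_i N` of width `k + 1` (D5 `stub_esymmRowSums_scan`), so THEOREM δ applies.
Contrast: over `ℝ≥0` the same polynomial at `k = ⌊n/2⌋` needs `≥ C(n, ⌊n/6⌋)` gates (THEOREM γ).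
[new] -/
theorem esymmRowSums_symmetric_circuit (n k : ℕ) :
    ∃ (G : Type) (_ : Fintype G) (C : LabelledArithCircuit ℂ (Fin n × Fin n) Unit G),
      C.IsSymmetric (Equiv.Perm (Fin n)) ∧
      C.eval (C.output ()) = MvPolynomial.bind₁ (fun i : Fin n => ∑ j : Fin n, MvPolynomial.X (i, j))
        (MvPolynomial.esymm (Fin n) ℂ k) ∧
      Fintype.card G ≤ (n + k + 7) ^ 24 := by
  obtain ⟨hcomm, hval⟩ := stub_esymmRowSums_scan n k
  have hcomm' : ∀ i i' : Fin n,
      (Matrix.of fun a b : Fin (k + 1) => MvPolynomial.aeval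
          (fun d : Fin 1 => ∑ j : Fin n, (MvPolynomial.X (i, j) : MvPolynomial (Fin n × Fin n) ℂ)
            ^ ((d : ℕ) + 1))
          ((if a = b then 1 else 0) +
            (if (a : ℕ) = (b : ℕ) + 1 then (MvPolynomial.X 0 : MvPolynomial (Fin 1) ℂ) else 0))) *
      (Matrix.of fun a b : Fin (k + 1) => MvPolynomial.aeval
          (fun d : Fin 1 => ∑ j : Fin n, (MvPolynomial.X (i', j) : MvPolynomial (Fin n × Fin n) ℂ)
            ^ ((d : ℕ) + 1))
          ((if a = b then 1 else 0) +
            (if (a : ℕ) = (b : ℕ) + 1 then (MvPolynomial.X 0 : MvPolynomial (Fin 1) ℂ) else 0))) =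
      (Matrix.of fun a b : Fin (k + 1) => MvPolynomial.aeval
          (fun d : Fin 1 => ∑ j : Fin n, (MvPolynomial.X (i', j) : MvPolynomial (Fin n × Fin n) ℂ)
            ^ ((d : ℕ) + 1))
          ((if a = b then 1 else 0) +
            (if (a : ℕ) = (b : ℕ) + 1 then (MvPolynomial.X 0 : MvPolynomial (Fin 1) ℂ) else 0))) *
      (Matrix.of fun a b : Fin (k + 1) => MvPolynomial.aeval
          (fun d : Fin 1 => ∑ j : Fin n, (MvPolynomial.X (i, j) : MvPolynomial (Fin n × Fin n) ℂ)
            ^ ((d : ℕ) + 1))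
          ((if a = b then 1 else 0) +
            (if (a : ℕ) = (b : ℕ) + 1 then (MvPolynomial.X 0 : MvPolynomial (Fin 1) ℂ) else 0))) := by
    intro i i'
    rw [esymmScan_powFun_eq n i, esymmScan_powFun_eq n i']
    exact hcomm i i'
  have hval' : (∑ a : Fin (k + 1), ∑ b : Fin (k + 1),
      MvPolynomial.C (if (a : ℕ) = k then (1 : ℂ) else 0) *
        (List.ofFn fun i : Fin n => Matrix.of fun a' b' : Fin (k + 1) => MvPolynomial.aeval
          (fun d : Fin 1 => ∑ j : Fin n, (MvPolynomial.X (i, j) : MvPolynomial (Fin n × Fin n) ℂ)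
            ^ ((d : ℕ) + 1))
          ((if a' = b' then 1 else 0) +
            (if (a' : ℕ) = (b' : ℕ) + 1 then (MvPolynomial.X 0 : MvPolynomial (Fin 1) ℂ) else 0))).prod
          a b *
        MvPolynomial.C (if (b : ℕ) = 0 then (1 : ℂ) else 0)) =
      MvPolynomial.bind₁ (fun i : Fin n => ∑ j : Fin n, MvPolynomial.X (i, j))
        (MvPolynomial.esymm (Fin n) ℂ k) := by
    have hfn : (fun i : Fin n => Matrix.of fun a' b' : Fin (k + 1) => MvPolynomial.aeval
          (fun d : Fin 1 => ∑ j : Fin n, (MvPolynomial.X (i, j) : MvPolynomial (Fin n × Fin n) ℂ)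
            ^ ((d : ℕ) + 1))
          ((if a' = b' then 1 else 0) +
            (if (a' : ℕ) = (b' : ℕ) + 1 then (MvPolynomial.X 0 : MvPolynomial (Fin 1) ℂ) else 0))) =
        (fun i : Fin n => Matrix.of fun a' b' : Fin (k + 1) => MvPolynomial.aeval
          (fun _ : Fin 1 => ∑ j : Fin n, (MvPolynomial.X (i, j) : MvPolynomial (Fin n × Fin n) ℂ)
            ^ ((0 : ℕ) + 1))
          ((if a' = b' then 1 else 0) +
            (if (a' : ℕ) = (b' : ℕ) + 1 then (MvPolynomial.X 0 : MvPolynomial (Fin 1) ℂ) else 0))) := by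
      funext i
      rw [esymmScan_powFun_eq n i]
    rw [hfn]
    exact hval
  obtain ⟨G, hG, C, hCs, hCe, hCc⟩ := rowScan_symmetric_circuit n (k + 1) 1 2 1
    (fun a b : Fin (k + 1) => (if a = b then 1 else 0) +
      (if (a : ℕ) = (b : ℕ) + 1 then (MvPolynomial.X 0 : MvPolynomial (Fin 1) ℂ) else 0))
    (esymmScan_template_support_card k) (esymmScan_template_totalDegree k)
    (fun a => if (a : ℕ) = k then (1 : ℂ) else 0) (fun b => if (b : ℕ) = 0 then (1 : ℂ) else 0) hcomm'
  refine ⟨G, hG, C, hCs, hCe.trans hval', hCc.trans (le_of_eq ?_)⟩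
  have : n + (k + 1) + 1 + 2 + 1 + 2 = n + k + 7 := by ring
  rw [this]

/-- Arithmetic: a polynomial bound is quasi-polynomial. [folklore] -/
theorem delta_poly_le_qp (c : ℕ) : ∃ c' : ℕ, ∀ n w D T Eh : ℕ,
    w ≤ (n + 2) ^ c → D ≤ (n + 2) ^ c → T ≤ (n + 2) ^ c → Eh ≤ (n + 2) ^ c →
    (n + w + D + T + Eh + 2) ^ 24 ≤ 2 ^ ((Nat.log 2 n + c') ^ c') := by
  refine ⟨24 * (c + 4) + 2, fun n w D T Eh hw hD hT hE => ?_⟩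
  have hL : n < 2 ^ (Nat.log 2 n + 1) := Nat.lt_pow_succ_log_self Nat.one_lt_two n
  generalize Nat.log 2 n = L at hL ⊢
  have hn2 : n + 2 ≤ 2 ^ (L + 2) := by
    have : 2 ^ (L + 2) = 2 ^ (L + 1) * 2 := by ring
    omega
  have hone : 1 ≤ (n + 2) ^ c := Nat.one_le_pow _ _ (by omega)
  -- the base is at most `(n+2)^(c+4)`
  have hbase : n + w + D + T + Eh + 2 ≤ (n + 2) ^ (c + 4) := by
    calc n + w + D + T + Eh + 2 ≤ (n + 2) + 4 * (n + 2) ^ c := by omega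
      _ ≤ (n + 2) * (n + 2) ^ c + 4 * (n + 2) ^ c := by
          have : n + 2 ≤ (n + 2) * (n + 2) ^ c := Nat.le_mul_of_pos_right _ hone
          omega
      _ = (n + 6) * (n + 2) ^ c := by ring
      _ ≤ (n + 2) ^ 4 * (n + 2) ^ c := by
          apply Nat.mul_le_mul_right
          have h3 : (n + 2) ^ 3 = n ^ 3 + 6 * n ^ 2 + 12 * n + 8 := by ring
          calc n + 6 ≤ (n + 2) ^ 3 := by rw [h3]; omega
            _ ≤ (n + 2) ^ 4 := Nat.pow_le_pow_right (by omega) (by omega)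
      _ = (n + 2) ^ (c + 4) := by rw [← pow_add]; ring_nf
  calc (n + w + D + T + Eh + 2) ^ 24 ≤ ((n + 2) ^ (c + 4)) ^ 24 := Nat.pow_le_pow_left hbase 24
    _ ≤ ((2 ^ (L + 2)) ^ (c + 4)) ^ 24 :=
        Nat.pow_le_pow_left (Nat.pow_le_pow_left hn2 _) 24
    _ = 2 ^ ((L + 2) * (24 * (c + 4))) := by rw [← pow_mul, ← pow_mul]; ring_nf
    _ ≤ 2 ^ ((L + (24 * (c + 4) + 2)) ^ (24 * (c + 4) + 2)) := by
        apply Nat.pow_le_pow_right (by norm_num)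
        set B : ℕ := L + (24 * (c + 4) + 2) with hB
        calc (L + 2) * (24 * (c + 4)) ≤ B * B := Nat.mul_le_mul (by omega) (by omega)
          _ = B ^ 2 := (pow_two B).symm
          _ ≤ B ^ (24 * (c + 4) + 2) := Nat.pow_le_pow_right (by omega) (by omega)

/-- **The commuting-scan SLICE OF THE CRUX** (in the currency of `MonotoneRestorationQP`): let
`f_n ∈ ℝ≥0[x_ij]` be any family (matrix symmetry, degree and monotone complexity are NOT used)
whose complexification is, for every `n`, the value of a COMMUTING row scan of width `w_n`, with
`D_n` power sums and templates of sparsity `T_n` and degree `Eh_n`, all `≤ (n+2)^c`. Then `f` has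
square-symmetric circuits over `ℂ` of size `≤ 2^{(log₂ n + c')^{c'}}` (in fact polynomial). This is
the crux restricted to the planners' feared "order-exploiting DPs" — they restore. [new] -/
theorem monotoneRestorationQP_of_commutingScan (c : ℕ) : ∃ c' : ℕ,
    ∀ (f : (n : ℕ) → MvPolynomial (Fin n × Fin n) NNReal)
      (w D T Eh : ℕ → ℕ) (H : (n : ℕ) → Fin (w n) → Fin (w n) → MvPolynomial (Fin (D n)) ℂ)
      (u v : (n : ℕ) → Fin (w n) → ℂ),
      (∀ n, w n ≤ (n + 2) ^ c ∧ D n ≤ (n + 2) ^ c ∧ T n ≤ (n + 2) ^ c ∧ Eh n ≤ (n + 2) ^ c) →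
      (∀ n a b, (H n a b).support.card ≤ T n) → (∀ n a b, (H n a b).totalDegree ≤ Eh n) →
      (∀ (n : ℕ) (i i' : Fin n),
        (Matrix.of fun a b : Fin (w n) => MvPolynomial.aeval
            (fun d : Fin (D n) => ∑ j : Fin n, (MvPolynomial.X (i, j) : MvPolynomial (Fin n × Fin n) ℂ)
              ^ ((d : ℕ) + 1)) (H n a b)) *
        (Matrix.of fun a b : Fin (w n) => MvPolynomial.aeval
            (fun d : Fin (D n) => ∑ j : Fin n, (MvPolynomial.X (i', j) : MvPolynomial (Fin n × Fin n) ℂ)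
              ^ ((d : ℕ) + 1)) (H n a b)) =
        (Matrix.of fun a b : Fin (w n) => MvPolynomial.aeval
            (fun d : Fin (D n) => ∑ j : Fin n, (MvPolynomial.X (i', j) : MvPolynomial (Fin n × Fin n) ℂ)
              ^ ((d : ℕ) + 1)) (H n a b)) *
        (Matrix.of fun a b : Fin (w n) => MvPolynomial.aeval
            (fun d : Fin (D n) => ∑ j : Fin n, (MvPolynomial.X (i, j) : MvPolynomial (Fin n × Fin n) ℂ)
              ^ ((d : ℕ) + 1)) (H n a b))) →
      (∀ n, MvPolynomial.map (Complex.ofRealHom.comp NNReal.toRealHom) (f n) =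
        ∑ a : Fin (w n), ∑ b : Fin (w n), MvPolynomial.C (u n a) *
          (List.ofFn fun i : Fin n => Matrix.of fun a' b' : Fin (w n) => MvPolynomial.aeval
            (fun d : Fin (D n) => ∑ j : Fin n, (MvPolynomial.X (i, j) : MvPolynomial (Fin n × Fin n) ℂ)
              ^ ((d : ℕ) + 1)) (H n a' b')).prod a b *
          MvPolynomial.C (v n b)) →
      ∀ n : ℕ, ∃ (G : Type) (_ : Fintype G) (C : LabelledArithCircuit ℂ (Fin n × Fin n) Unit G),
        C.IsSymmetric (Equiv.Perm (Fin n)) ∧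
        C.eval (C.output ()) = MvPolynomial.map (Complex.ofRealHom.comp NNReal.toRealHom) (f n) ∧
        Fintype.card G ≤ 2 ^ ((Nat.log 2 n + c') ^ c') := by
  obtain ⟨c', hc'⟩ := delta_poly_le_qp c
  refine ⟨c', fun f w D T Eh H u v hbd hT hE hcomm hf n => ?_⟩
  obtain ⟨G, hG, C, hCs, hCe, hCc⟩ :=
    rowScan_symmetric_circuit n (w n) (D n) (T n) (Eh n) (H n) (hT n) (hE n) (u n) (v n) (hcomm n)
  refine ⟨G, hG, C, hCs, hCe.trans (hf n).symm, hCc.trans ?_⟩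
  exact hc' n (w n) (D n) (T n) (Eh n) (hbd n).1 (hbd n).2.1 (hbd n).2.2.1 (hbd n).2.2.2

end Summit.ValiantsHypothesis.ValiantsHypothesis.Theorems
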